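import Literature.NumberTheory.EllipticCurves.WeierstrassScheme
import Literature.NumberTheory.EllipticCurves.AbelianVarietyModelIsogeny
import Literature.AlgebraicGeometry.Motives.HypersurfaceFieldPoints
import Literature.AlgebraicGeometry.Motives.ProjBasicOpenSubscheme
import Literature.AlgebraicGeometry.Motives.HypersurfaceChartAlgebra
import Mathlib.RingTheory.Spectrum.Prime.RingHom
import HarnessLib

/-!
# The affine chart `Spec K[W] ↪ E_W` of the Weierstrass plane cubic

For a Weierstrass curve `W` over a field `K` let `E_W = V₊(F) ⊂ ℙ²_K` be its plane cubic as a
`K`-scheme (`WeierstrassCurve.scheme`, the reduced hypersurface of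
`EllipticCurves/WeierstrassScheme`). This file constructs the **affine chart**
`WeierstrassCurve.affineChart W : Spec K[W] → E_W` over `K` — Mathlib's affine Weierstrass curve
`Spec K[X, Y]/(W(X, Y))` embedded as the open piece `E_W ∩ D₊(Z)` (Silverman, *AEC* III.1:
"`E ⊂ ℙ²` … using non-homogeneous coordinates `x = X/Z`, `y = Y/Z`"; Hartshorne II Prop. 2.5 /
I Ex. 2.9: `V₊(F) ∩ D₊(Z) ≅ V(F(x, y, 1))`):

* `evalAffine : K[y₀, y₁] → K[W]` (`y₀ ↦ x`, `y₁ ↦ y`) is surjective with kernel generated by the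
  dehomogenised cubic `F(y₀, y₁, 1) = W(y₀, y₁)` (`ker_evalAffine`, `dehomogenize_polynomial`);
  with the chart algebra `(K[X,Y,Z]_{(Z)})₀ ≅ K[y₀, y₁]` of `Motives/VarietiesProjectiveSpaceProofs`
  (`ProjectiveSpace.ofChart`) this gives the surjection `awayToAffine : (K[X,Y,Z]_{(Z)})₀ → K[W]`
  with kernel generated by `F/Z³` (`ker_awayToAffine`);
* hence `toProjectivePlane : Spec K[W] → D₊(Z) → ℙ²_K` over `K`, a closed immersion into
  `D₊(Z)` followed by the open chart, with image exactly `V₊(F) ∩ D₊(Z)`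
  (`range_toProjectivePlane_left`);
* `affineChart : Spec K[W] → E_W` over `K`, the factorisation through the reduced closed subscheme
  `E_W` (`Motives/HypersurfaceFieldPoints.liftOfRangeSubset`), with
  `affineChart ≫ schemeι = toProjectivePlane` and image `schemeι⁻¹ D₊(Z)` (`range_affineChart_left`);
* on points: the `L`-point of `E_W` through the chart with affine coordinates `(x, y)`
  (`WeierstrassCurve.chartPoint` of `EllipticCurves/AbelianVarietyModel`) is the point with
  homogeneous coordinates `[x : y : 1]` (`chartPoint_affineChart`, AEC III.1 / III.2).

That `affineChart` is an *open immersion* (it is a surjective closed immersion onto the reduced open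
subscheme `E_W ∩ D₊(Z)`) is proved in the sequel; together these supply the chart `c` of
`WeierstrassCurve.IsAbelianVarietyModel` for the model `E_W`.

## References

* [SilvermanAEC2009] J. H. Silverman, *The Arithmetic of Elliptic Curves*, 2nd ed., III.1.
* [Hartshorne1977] R. Hartshorne, *Algebraic Geometry*, I Ex. 2.9, II Prop. 2.5, II Ex. 3.11.

## Design

`namespace WeierstrassCurve` (dot-notation extensions, as `WeierstrassScheme`); the graded-algebra
instances are the local ones of the `Motives/ProjectiveSpace*` files.
-/

noncomputable section

open CategoryTheory AlgebraicGeometry HomogeneousLocalization MvPolynomial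
open Literature.AlgebraicGeometry.Motives
open scoped Polynomial.Bivariate

universe u

namespace WeierstrassCurve

variable {K : Type u} [Field K] (W : WeierstrassCurve K)

attribute [local instance] MvPolynomial.gradedAlgebra ProjBaseChange.algebraBase
  ProjBaseChange.isScalarTower_localization

local notation "𝒜" => MvPolynomial.homogeneousSubmodule (Fin 3) K

/-! ## `K[y₀, y₁] → K[W]` -/

/-- Evaluation `K[y₀, y₁] → K[W] = K[X, Y]/(W(X, Y))`, `y₀ ↦ x`, `y₁ ↦ y` (the coordinate functions
`x = X/Z`, `y = Y/Z` of Silverman, *AEC* III.1). [cite: SilvermanAEC2009, III.1] -/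
def evalAffine : MvPolynomial (Fin 2) K →ₐ[K] W.toAffine.CoordinateRing :=
  aeval ![xClass W, yClass W]

/-- `evalAffine y₀ = x̄`. [folklore] -/
@[simp]
theorem evalAffine_X_zero : W.evalAffine (X 0) = xClass W := by
  simp [evalAffine]

/-- `evalAffine y₁ = ȳ`. [folklore] -/
@[simp]
theorem evalAffine_X_one : W.evalAffine (X 1) = yClass W := by
  simp [evalAffine]

/-- `K[y₀, y₁] → K[X][Y]`, `y₀ ↦ X`, `y₁ ↦ Y` (inverse of `toMv K`). [folklore] -/
def fromMv : MvPolynomial (Fin 2) K →ₐ[K] K[X][Y] :=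
  aeval ![Polynomial.C Polynomial.X, (Polynomial.X : K[X][Y])]

/-- `fromMv y₀ = X`. [folklore] -/
@[simp]
theorem fromMv_X_zero : fromMv (K := K) (X 0) = Polynomial.C Polynomial.X := by
  simp [fromMv]

/-- `fromMv y₁ = Y`. [folklore] -/
@[simp]
theorem fromMv_X_one : fromMv (K := K) (X 1) = (Polynomial.X : K[X][Y]) := by
  simp [fromMv]

/-- `toMv ∘ fromMv = id`. [folklore] -/
theorem toMv_fromMv (q : MvPolynomial (Fin 2) K) : toMv K (fromMv q) = q := by
  have key : ((toMv K).comp (fromMv (K := K) : MvPolynomial (Fin 2) K →+* K[X][Y])) =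
      RingHom.id _ := by
    refine MvPolynomial.ringHom_ext (fun a ↦ ?_) (fun j ↦ ?_)
    · rw [RingHom.comp_apply, RingHom.id_apply, AlgHom.coe_toRingHom, ← MvPolynomial.algebraMap_eq,
        AlgHom.commutes, Polynomial.algebraMap_apply, Polynomial.algebraMap_eq, toMv_C_C]
      rfl
    · fin_cases j
      · change toMv K (fromMv (X 0)) = X 0
        rw [fromMv_X_zero, toMv_C_X]
      · change toMv K (fromMv (X 1)) = X 1
        rw [fromMv_X_one, toMv_Y]
  exact congrArg (fun ψ : MvPolynomial (Fin 2) K →+* MvPolynomial (Fin 2) K ↦ ψ q) key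

/-- `K[y₀, y₁] → K[X][Y] → K[W]` is `evalAffine`. [folklore] -/
theorem mk_fromMv (q : MvPolynomial (Fin 2) K) :
    Affine.CoordinateRing.mk W.toAffine (fromMv q) = W.evalAffine q := by
  have key : (Affine.CoordinateRing.mk W.toAffine).comp
      (fromMv (K := K) : MvPolynomial (Fin 2) K →+* K[X][Y]) =
      (W.evalAffine : MvPolynomial (Fin 2) K →+* W.toAffine.CoordinateRing) := by
    refine MvPolynomial.ringHom_ext (fun a ↦ ?_) (fun j ↦ ?_)
    · change Affine.CoordinateRing.mk W.toAffine (fromMv (C a)) = W.evalAffine (C a)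
      rw [← MvPolynomial.algebraMap_eq, AlgHom.commutes, AlgHom.commutes, Polynomial.algebraMap_apply,
        Polynomial.algebraMap_eq, AdjoinRoot.mk_C, ← AdjoinRoot.algebraMap_eq, ← Polynomial.algebraMap_eq,
        ← IsScalarTower.algebraMap_apply]
    · fin_cases j
      · change Affine.CoordinateRing.mk W.toAffine (fromMv (X 0)) = W.evalAffine (X 0)
        rw [fromMv_X_zero, evalAffine_X_zero]
      · change Affine.CoordinateRing.mk W.toAffine (fromMv (X 1)) = W.evalAffine (X 1)
        rw [fromMv_X_one, evalAffine_X_one]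
  exact congrArg (fun ψ : MvPolynomial (Fin 2) K →+* W.toAffine.CoordinateRing ↦ ψ q) key

/-- `K[X][Y] → K[y₀, y₁] → K[W]` is the quotient map. [folklore] -/
theorem evalAffine_toMv (p : K[X][Y]) : W.evalAffine (toMv K p) = Affine.CoordinateRing.mk W.toAffine p := by
  have key : ((W.evalAffine : MvPolynomial (Fin 2) K →+* W.toAffine.CoordinateRing).comp (toMv K)) =
      Affine.CoordinateRing.mk W.toAffine := by
    refine Polynomial.ringHom_ext' (Polynomial.ringHom_ext' ?_ ?_) ?_
    · ext a
      change W.evalAffine (toMv K (Polynomial.C (Polynomial.C a))) =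
        Affine.CoordinateRing.mk W.toAffine (Polynomial.C (Polynomial.C a))
      rw [toMv_C_C, Algebra.algebraMap_self_apply, ← MvPolynomial.algebraMap_eq, AlgHom.commutes,
        AdjoinRoot.mk_C, ← AdjoinRoot.algebraMap_eq, ← Polynomial.algebraMap_eq,
        ← IsScalarTower.algebraMap_apply]
    · change W.evalAffine (toMv K (Polynomial.C Polynomial.X)) = xClass W
      rw [toMv_C_X, evalAffine_X_zero]
    · change W.evalAffine (toMv K Polynomial.X) = yClass W
      rw [toMv_Y, evalAffine_X_one]
  exact congrArg (fun ψ : K[X][Y] →+* W.toAffine.CoordinateRing ↦ ψ p) key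

/-- `evalAffine` is surjective. [folklore] -/
theorem evalAffine_surjective : Function.Surjective W.evalAffine := fun a ↦ by
  obtain ⟨p, rfl⟩ := AdjoinRoot.mk_surjective a
  exact ⟨toMv K p, W.evalAffine_toMv p⟩

/-- **The kernel of `K[y₀, y₁] → K[W]` is generated by the affine cubic** `W(y₀, y₁)`.
[cite: SilvermanAEC2009, III.1] -/
theorem ker_evalAffine :
    RingHom.ker (W.evalAffine : MvPolynomial (Fin 2) K →+* W.toAffine.CoordinateRing) =
      Ideal.span {toMv K W.toAffine.polynomial} := by
  apply le_antisymm
  · intro q hq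
    rw [RingHom.mem_ker, AlgHom.coe_toRingHom, ← mk_fromMv, AdjoinRoot.mk_eq_zero] at hq
    obtain ⟨c, hc⟩ := hq
    rw [← toMv_fromMv q, hc, map_mul]
    exact Ideal.mul_mem_right _ _ (Ideal.subset_span rfl)
  · rw [Ideal.span_le, Set.singleton_subset_iff, SetLike.mem_coe, RingHom.mem_ker,
      AlgHom.coe_toRingHom, evalAffine_toMv]
    exact AdjoinRoot.mk_self

/-! ## The dehomogenised cubic -/

/-- **Dehomogenising the Weierstrass cubic at `Z` gives the affine Weierstrass polynomial**:
`F(y₀, y₁, 1) = W(y₀, y₁)` (Silverman, *AEC* III.1, `x = X/Z`, `y = Y/Z`). [cite: SilvermanAEC2009, III.1] -/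
theorem dehomogenize_polynomial :
    ProjectiveSpace.dehomogenize K (2 : Fin 3) W.toProjective.polynomial = toMv K W.toAffine.polynomial := by
  have h0 : ProjectiveSpace.dehomogenize K (2 : Fin 3) (X 0) = X 0 :=
    ProjectiveSpace.dehomogenize_X_succAbove K (2 : Fin 3) 0
  have h1 : ProjectiveSpace.dehomogenize K (2 : Fin 3) (X 1) = X 1 :=
    ProjectiveSpace.dehomogenize_X_succAbove K (2 : Fin 3) 1
  have h2 : ProjectiveSpace.dehomogenize K (2 : Fin 3) (X 2) = 1 :=
    ProjectiveSpace.dehomogenize_X_self K (2 : Fin 3)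
  simp only [Projective.polynomial, map_add, map_sub, map_mul, map_pow, MvPolynomial.algHom_C, h0, h1,
    h2, Affine.polynomial, toMv, Polynomial.eval₂_C, Polynomial.eval₂_X, Polynomial.coe_eval₂RingHom,
    RingHom.coe_comp, Function.comp_apply, MvPolynomial.algebraMap_eq, Algebra.algebraMap_self,
    RingHom.id_apply]
  ring

/-! ## `(K[X, Y, Z]_{(Z)})₀ → K[W]` -/

/-- The Weierstrass cubic is homogeneous of degree `3` (membership form). [folklore] -/
theorem polynomial_mem : W.toProjective.polynomial ∈ 𝒜 3 :=
  W.toProjective.polynomial_mem_homogeneousSubmodule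

/-- **`(K[X, Y, Z]_{(Z)})₀ → K[W]`**: dehomogenise (`ProjectiveSpace.ofChart`, `Z := 1`) and evaluate
(`x = X/Z ↦ x̄`, `y = Y/Z ↦ ȳ`; Silverman, *AEC* III.1). [cite: SilvermanAEC2009, III.1] -/
def awayToAffine : Away 𝒜 (X 2) →ₐ[K] W.toAffine.CoordinateRing :=
  W.evalAffine.comp (ProjectiveSpace.ofChart K (2 : Fin 3))

/-- `ofChart` is surjective (it is an isomorphism). [folklore] -/
theorem ofChart_surjective : Function.Surjective (ProjectiveSpace.ofChart K (2 : Fin 3)) := fun q ↦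
  ⟨ProjectiveSpace.toChart K (2 : Fin 3) q,
    congrArg (fun ψ : MvPolynomial (Fin 2) K →ₐ[K] MvPolynomial (Fin 2) K ↦ ψ q)
      (ProjectiveSpace.ofChart_comp_toChart K (2 : Fin 3))⟩

/-- `awayToAffine` is surjective. [folklore] -/
theorem awayToAffine_surjective : Function.Surjective W.awayToAffine :=
  W.evalAffine_surjective.comp ofChart_surjective

/-- `ofChart (toChart q) = q`. [folklore] -/
theorem ofChart_toChart (q : MvPolynomial (Fin 2) K) :
    ProjectiveSpace.ofChart K (2 : Fin 3) (ProjectiveSpace.toChart K (2 : Fin 3) q) = q :=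
  congrArg (fun ψ : MvPolynomial (Fin 2) K →ₐ[K] MvPolynomial (Fin 2) K ↦ ψ q)
    (ProjectiveSpace.ofChart_comp_toChart K (2 : Fin 3))

/-- **`F/Z³ ↦ 0`**: the dehomogenised cubic is the affine relation. [cite: SilvermanAEC2009, III.1] -/
theorem awayToAffine_isLocalizationElem :
    W.awayToAffine (Away.isLocalizationElem (ProjectiveSpace.X_mem (2 : Fin 3)) W.polynomial_mem) = 0 := by
  rw [awayToAffine, AlgHom.comp_apply, ProjectiveSpace.isLocalizationElem_X, ofChart_toChart,
    dehomogenize_polynomial, evalAffine_toMv]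
  exact AdjoinRoot.mk_self

/-- **The kernel of `(K[X, Y, Z]_{(Z)})₀ → K[W]` is generated by `F/Z³`** (Hartshorne I Ex. 2.9 /
II Prop. 2.5: `V₊(F) ∩ D₊(Z)` is cut out by `F(x, y, 1)`). [cite: Hartshorne1977, II Prop. 2.5] -/
theorem ker_awayToAffine :
    RingHom.ker (W.awayToAffine : Away 𝒜 (X 2) →+* W.toAffine.CoordinateRing) =
      Ideal.span {Away.isLocalizationElem (ProjectiveSpace.X_mem (2 : Fin 3)) W.polynomial_mem} := by
  apply le_antisymm
  · intro q hq
    have hq' : ProjectiveSpace.ofChart K (2 : Fin 3) q ∈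
        RingHom.ker (W.evalAffine : MvPolynomial (Fin 2) K →+* W.toAffine.CoordinateRing) := hq
    rw [ker_evalAffine, Ideal.mem_span_singleton] at hq'
    obtain ⟨c, hc⟩ := hq'
    rw [← ProjectiveSpace.toChart_ofChart (2 : Fin 3) q, hc, map_mul, ← dehomogenize_polynomial,
      ← ProjectiveSpace.isLocalizationElem_X (2 : Fin 3) W.toProjective.polynomial W.polynomial_mem]
    exact Ideal.mul_mem_right _ _ (Ideal.subset_span rfl)
  · rw [Ideal.span_le, Set.singleton_subset_iff, SetLike.mem_coe, RingHom.mem_ker]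
    exact W.awayToAffine_isLocalizationElem

/-! ## `Spec K[W] → D₊(Z) → ℙ²_K` -/

/-- `Spec K[W]` as a `K`-scheme. [folklore] -/
abbrev affineOver : SchemeOver K :=
  specOver K W.toAffine.CoordinateRing

/-- `Spec K[W]` is reduced (`K[W]` is a domain). [folklore] -/
instance isReduced_affineOver_left : IsReduced W.affineOver.left :=
  inferInstanceAs (IsReduced (Spec (CommRingCat.of W.toAffine.CoordinateRing)))

/-- **`Spec K[W] → Spec (K[X, Y, Z]_{(Z)})₀ = D₊(Z)`**, `Spec` of `awayToAffine` (a closed immersion).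
[cite: Hartshorne1977, II Prop. 2.5] -/
def toAwayChart : W.affineOver ⟶ specOver K (Away 𝒜 (X 2)) :=
  Over.homMk (Spec.map (CommRingCat.ofHom W.awayToAffine.toRingHom)) <| by
    change Spec.map (CommRingCat.ofHom W.awayToAffine.toRingHom) ≫ Spec.map _ = Spec.map _
    rw [← Spec.map_comp, ← CommRingCat.ofHom_comp, AlgHom.toRingHom_eq_coe, AlgHom.comp_algebraMap]

/-- Underlying morphism of `toAwayChart`. [folklore] -/
@[simp]
theorem toAwayChart_left :
    W.toAwayChart.left = Spec.map (CommRingCat.ofHom W.awayToAffine.toRingHom) := rfl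

/-- `Spec K[W] → D₊(Z)` is a closed immersion (`awayToAffine` is surjective). [folklore] -/
instance isClosedImmersion_toAwayChart_left : IsClosedImmersion W.toAwayChart.left :=
  IsClosedImmersion.spec_of_surjective _ W.awayToAffine_surjective

/-- **`Spec K[W] → ℙ²_K`** over `K`: the closed immersion into the chart `D₊(Z)` followed by the open
immersion `D₊(Z) ⊆ ℙ²_K` (Silverman, *AEC* III.1: the affine piece `Z ≠ 0` of the plane cubic).
[cite: SilvermanAEC2009, III.1] -/
def toProjectivePlane : W.affineOver ⟶ projectiveSpace 2 K :=
  W.toAwayChart ≫ ProjectiveSpace.awayChartι (ProjectiveSpace.X_mem (2 : Fin 3)) one_pos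

/-- Underlying morphism of `toProjectivePlane`. [folklore] -/
theorem toProjectivePlane_left : W.toProjectivePlane.left =
    Spec.map (CommRingCat.ofHom W.awayToAffine.toRingHom) ≫
      Proj.awayι 𝒜 (X 2) (ProjectiveSpace.X_mem (2 : Fin 3)) one_pos := rfl

/-- The image of `Spec K[W] → D₊(Z)` is the zero locus of `F/Z³`. [folklore] -/
theorem range_specMap_awayToAffine :
    Set.range (Spec.map (CommRingCat.ofHom W.awayToAffine.toRingHom)) =
      PrimeSpectrum.zeroLocus {Away.isLocalizationElem (ProjectiveSpace.X_mem (2 : Fin 3)) W.polynomial_mem} := by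
  change Set.range (PrimeSpectrum.comap (W.awayToAffine : Away 𝒜 (X 2) →+* W.toAffine.CoordinateRing)) = _
  rw [range_comap_of_surjective _ (W.awayToAffine : Away 𝒜 (X 2) →+* W.toAffine.CoordinateRing)
    W.awayToAffine_surjective, ker_awayToAffine]
  exact PrimeSpectrum.zeroLocus_span _

/-- **The image of `Spec K[W] → ℙ²_K` is `V₊(F) ∩ D₊(Z)`** (Hartshorne I Ex. 2.9 / II Prop. 2.5).
[cite: Hartshorne1977, II Prop. 2.5] -/
theorem range_toProjectivePlane_left : Set.range W.toProjectivePlane.left =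
    ProjectiveSpectrum.zeroLocus 𝒜 {W.toProjective.polynomial} ∩ (Proj.basicOpen 𝒜 (X 2) : Set (Proj 𝒜)) := by
  have h1 : Set.range W.toProjectivePlane.left =
      Proj.awayι 𝒜 (X 2) (ProjectiveSpace.X_mem (2 : Fin 3)) one_pos ''
        Set.range (Spec.map (CommRingCat.ofHom W.awayToAffine.toRingHom)) := by
    rw [← Set.range_comp]
    rfl
  have h2 : Set.range (Proj.awayι 𝒜 (X 2) (ProjectiveSpace.X_mem (2 : Fin 3)) one_pos) =
      (Proj.basicOpen 𝒜 (X 2) : Set (Proj 𝒜)) :=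
    congrArg (fun U : (Proj 𝒜).Opens ↦ (U : Set (Proj 𝒜)))
      (Proj.opensRange_awayι 𝒜 (X 2) (ProjectiveSpace.X_mem (2 : Fin 3)) one_pos)
  rw [h1, range_specMap_awayToAffine, ← ProjSubscheme.awayι_preimage_zeroLocus 𝒜
    (ProjectiveSpace.X_mem (2 : Fin 3)) one_pos W.polynomial_mem three_pos,
    Set.image_preimage_eq_inter_range, h2]
  rfl

/-- The image of `Spec K[W] → ℙ²_K` lies on the cubic `V₊(F) = E_W`. [folklore] -/
theorem range_toProjectivePlane_subset :
    Set.range W.toProjectivePlane.left ⊆ Set.range W.schemeι.left := by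
  rw [range_toProjectivePlane_left, range_schemeι]
  exact Set.inter_subset_left

/-! ## The affine chart `Spec K[W] → E_W` -/

/-- **The affine chart `Spec K[W] → E_W` of the Weierstrass plane cubic** over `K`: the morphism
`Spec K[W] → ℙ²_K` onto `V₊(F) ∩ D₊(Z)` factored through the reduced closed subscheme `E_W = V₊(F)`
(Silverman, *AEC* III.1; Hartshorne II Ex. 3.11(d), the tree's `liftOfRangeSubset`).
[cite: SilvermanAEC2009, III.1] -/
def affineChart : W.affineOver ⟶ W.scheme :=
  Over.homMk (liftOfRangeSubset W.schemeι.left W.toProjectivePlane.left W.range_toProjectivePlane_subset) <| by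
    rw [← W.schemeι_comp_hom, liftOfRangeSubset_comp_assoc]
    exact Over.w W.toProjectivePlane

/-- Underlying morphisms: `affineChart.left ≫ schemeι.left = toProjectivePlane.left`. [folklore] -/
theorem affineChart_left_comp : W.affineChart.left ≫ W.schemeι.left = W.toProjectivePlane.left :=
  liftOfRangeSubset_comp W.schemeι.left W.toProjectivePlane.left W.range_toProjectivePlane_subset

/-- `affineChart` followed by `E_W ↪ ℙ²_K` is `toProjectivePlane`. [folklore] -/
theorem affineChart_comp_schemeι : W.affineChart ≫ W.schemeι = W.toProjectivePlane :=
  Over.OverMorphism.ext W.affineChart_left_comp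

/-- The affine chart is a morphism of `K`-schemes. [folklore] -/
theorem affineChart_over : W.affineChart.left ≫ W.scheme.hom =
    Spec.map (CommRingCat.ofHom (algebraMap K W.toAffine.CoordinateRing)) :=
  Over.w W.affineChart

/-- **The image of the affine chart is `E_W ∩ D₊(Z)`** (`schemeι⁻¹ D₊(Z)`). [cite: SilvermanAEC2009, III.1] -/
theorem range_affineChart_left :
    Set.range W.affineChart.left = W.schemeι.left ⁻¹' (Proj.basicOpen 𝒜 (X 2) : Set (Proj 𝒜)) := by
  ext e
  constructor
  · rintro ⟨p, rfl⟩
    have hp : W.schemeι.left (W.affineChart.left p) ∈ Set.range W.toProjectivePlane.left :=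
      ⟨p, by rw [← Scheme.Hom.comp_apply, affineChart_left_comp]⟩
    rw [range_toProjectivePlane_left] at hp
    exact hp.2
  · intro he
    have he' : W.schemeι.left e ∈ Set.range W.toProjectivePlane.left := by
      rw [range_toProjectivePlane_left]
      exact ⟨by rw [← range_schemeι]; exact ⟨e, rfl⟩, he⟩
    obtain ⟨p, hp⟩ := he'
    refine ⟨p, W.schemeι.left.isClosedEmbedding.injective ?_⟩
    rw [← Scheme.Hom.comp_apply, affineChart_left_comp, hp]

/-! ## Points: the chart point `(x, y)` is `[x : y : 1]` -/

section Points

variable {L : Type u} [Field L] [Algebra K L] (x y : L)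

/-- `[x : y : 1] ≠ 0`. [folklore] -/
theorem vec_ne_zero : (![x, y, 1] : Fin 3 → L) ≠ 0 := fun h0 ↦
  one_ne_zero (congrFun h0 2)

/-- `F(x, y, 1) = 0` for a solution `(x, y)` of the Weierstrass equation (Mathlib
`WeierstrassCurve.Projective.equation_some`). [folklore] -/
theorem aeval_vec_polynomial (h : (W.baseChange L).toAffine.Equation x y) : aeval ![x, y, 1] W.toProjective.polynomial = 0 := by
  have h' : (W.baseChange L).toProjective.Equation ![x, y, 1] :=
    (Projective.equation_some x y).mpr h
  rw [Projective.Equation] at h'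
  rwa [MvPolynomial.aeval_def, ← MvPolynomial.eval_map, ← Projective.map_polynomial]

/-- On the generators `xⱼ/Z` the composite `(K[X,Y,Z]_{(Z)})₀ → K[W] → L` takes the values
`x, y, 1`. [folklore] -/
theorem affineEval_awayToAffine_coord (h : (W.baseChange L).toAffine.Equation x y) (j : Fin 3) :
    W.affineEval x y h (W.awayToAffine (ProjectiveSpace.coord (2 : Fin 3) j)) = ![x, y, 1] j := by
  fin_cases j
  · change W.affineEval x y h (W.awayToAffine (ProjectiveSpace.coord (2 : Fin 3) ((2 : Fin 3).succAbove 0))) = x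
    have hg : ProjectiveSpace.chartGen K (2 : Fin 3) 0 = ProjectiveSpace.toChart K (2 : Fin 3) (X 0) :=
      (MvPolynomial.aeval_X _ 0).symm
    rw [ProjectiveSpace.coord_succAbove, awayToAffine, AlgHom.comp_apply, hg, ofChart_toChart,
      evalAffine_X_zero, affineEval_xClass]
  · change W.affineEval x y h (W.awayToAffine (ProjectiveSpace.coord (2 : Fin 3) ((2 : Fin 3).succAbove 1))) = y
    have hg : ProjectiveSpace.chartGen K (2 : Fin 3) 1 = ProjectiveSpace.toChart K (2 : Fin 3) (X 1) :=
      (MvPolynomial.aeval_X _ 1).symm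
    rw [ProjectiveSpace.coord_succAbove, awayToAffine, AlgHom.comp_apply, hg, ofChart_toChart,
      evalAffine_X_one, affineEval_yClass]
  · change W.affineEval x y h (W.awayToAffine (ProjectiveSpace.coord (2 : Fin 3) 2)) = 1
    rw [ProjectiveSpace.coord_self, map_one, map_one]

/-- `Z(x, y, 1) = 1 ≠ 0`. [folklore] -/
theorem aeval_vec_X_two : aeval ![x, y, 1] (X 2 : MvPolynomial (Fin 3) K) ≠ 0 := by
  rw [MvPolynomial.aeval_X]
  exact one_ne_zero

/-- **The `K`-algebra map `(K[X,Y,Z]_{(Z)})₀ → K[W] → L` of the chart point `(x, y)` is evaluation at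
`[x : y : 1]`** (`ProjectiveSpace.awayEval`). [folklore] -/
theorem affineEval_comp_awayToAffine (h : (W.baseChange L).toAffine.Equation x y) :
    (W.affineEval x y h).comp W.awayToAffine =
      ProjectiveSpace.awayEval (t := X 2) ![x, y, 1] (aeval_vec_X_two x y) := by
  have key := ProjectiveSpace.awayEval_coord_eq (2 : Fin 3) ((W.affineEval x y h).comp W.awayToAffine)
  have hz : (fun j ↦ (W.affineEval x y h).comp W.awayToAffine (ProjectiveSpace.coord (2 : Fin 3) j)) =
      ![x, y, 1] := funext fun j ↦ W.affineEval_awayToAffine_coord x y h j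
  rw [← key]
  congr 1

/-- **The chart point `(x, y)` of `E_W` is the point with homogeneous coordinates `[x : y : 1]`**
(Silverman, *AEC* III.1–III.2: the affine point `(x, y)` is `[x, y, 1]`). [cite: SilvermanAEC2009, III.1] -/
theorem chartPoint_affineChart (h : (W.baseChange L).toAffine.Equation x y) :
    W.chartPoint (X := W.scheme) W.affineChart.left W.affineChart_over x y h =
      SmoothHypersurface.pointOfVec (n := 1) W.toProjective.polynomial W.toProjective.isHomogeneous_polynomial
        three_pos ![x, y, 1] (vec_ne_zero x y) (W.aeval_vec_polynomial x y h) := by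
  apply AlgPoints.map_injective_of_mono W.schemeι
  have hr : AlgPoints.map W.schemeι (SmoothHypersurface.pointOfVec (n := 1) W.toProjective.polynomial
      W.toProjective.isHomogeneous_polynomial three_pos ![x, y, 1] (vec_ne_zero x y)
      (W.aeval_vec_polynomial x y h)) = ProjectiveSpace.pointOfVec K ![x, y, 1] (vec_ne_zero x y) :=
    SmoothHypersurface.map_hypersurfaceι_pointOfVec _ _ _ _ _ _
  rw [hr, ProjectiveSpace.pointOfVec_eq_chartPoint _ _ (ProjectiveSpace.X_mem (2 : Fin 3)) one_pos
    (aeval_vec_X_two x y)]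
  ext : 1
  rw [AlgPoints.map_apply, ProjectiveSpace.chartPoint_left, ← W.affineEval_comp_awayToAffine x y h]
  change (Spec.map _ ≫ W.affineChart.left) ≫ W.schemeι.left = _
  rw [Category.assoc]
  erw [W.affineChart_left_comp]
  rw [toProjectivePlane_left, AlgHom.toRingHom_eq_coe, AlgHom.toRingHom_eq_coe, AlgHom.toRingHom_eq_coe,
    AlgHom.comp_toRingHom, CommRingCat.ofHom_comp, Spec.map_comp]
  rfl

end Points

end WeierstrassCurve
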